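import Literature.Geometry.Kaehler.ComplexTorusShiodaMitaniSelfProductsTwoTorsion
import HarnessLib

/-!
# Shioda–Mitani §4 / Ma 2011 §5.3: the counts `δ(A)`, `δ₀(A)` are well defined, and the singular abelian
# surfaces with primitive `T_A` and decomposition number `δ(A) = 1` — `Dec(A) = {(E, E)} ⟺ h(D) = 1`
# (Ma, Example 5.13) and `Dec(A) = {(E₁, E₂)}, E₁ ≄ E₂ ⟺ h(D) = 2 ∧ [T_A] ≠ 1` (Ma, Example 5.14)

Layer `Literature/Geometry/Kaehler`, namespace `Literature.Geometry.Kaehler.ComplexTorus.ShiodaMitani`; lane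
`lit-hodgefound` (Track 2 foundations library, Layer A4 "Hodge classes / known cases"), seat p18 gen 17, row
g17-#3 — directly beneath rows g16-#1 (`…SelfProductDecompositions`: Thm. 4.7 `2δ = h(D) + δ₀`), g16-#2
(`…AmbiguousClasses`: `δ₀ ∈ {0, h₂}`) and g16-#4 (`…SelfProductsTwoTorsion`: `δ₀ = 0` off the principal class when
every class is ambiguous; `h = 1 ⟹ δ = δ₀ = 1`).  THEOREMS ONLY — no definition, no named fact (D-0026; net
Literature debt `0`); landed statements are consumed BY NAME.

## Sources, VERBATIM

S. Ma, *Decompositions of an Abelian surface and quadratic forms*, Ann. Inst. Fourier **61** (2011)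
[Ma2011DecompositionsAbelianSurface] (held `paper:arxiv-0906.0412`, p0013–p0014): "**5.3 Abelian surfaces with
decomposition number 1.** We shall study Abelian surfaces with `ρ(A) = 4` and `δ(A) = 1`.  Such Abelian surfaces can
be classified as follows: (i) `T_A` is primitive, `δ̃(A) = 1`. (ii) `T_A` is primitive, `δ̃(A) = 2`. (iii) `T_A` is
not primitive, `δ̃(A) = 2`."  "**Example 5.13.** Let `A` be an Abelian surface such that `ρ(A) = 4` and
`Dec(A) = {(E, E)}` for an elliptic curve `E`.  Then `E` is isomorphic to one of the following thirteen elliptic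
curves […] *Proof.* By Corollary 5.8 and Shioda-Mitani formula (5.5), we have `δ̃(A) = 1` if and only if `T_A` is
primitive and the class number `|𝒞(𝒪)|` of the corresponding order `𝒪` is equal to `1`."  "**Example 5.14.**
There exist natural one-to-one correspondences between the following two sets: (a) The set of isomorphism classes of
Abelian surfaces `A` with `ρ(A) = 4` such that `T_A` is primitive and `Dec(A) = {(E₁, E₂)}`, `E₁ ≄ E₂`.  (b) The
set of imaginary quadratic order with class number `2`.  *Proof.* For an Abelian surface `A` in the set (a), let
`𝒪(A)` be the order with `d(𝒪(A)) = -det(T_A)`.  By Shioda-Mitani formula we have `|𝒞(𝒪)| = 2`.  Then `T_A`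
corresponds to the non-trivial element of the class group `𝒞(𝒪)`.  Conversely, for an order `𝒪` in the set (b),
let `T` be the even lattice corresponding to the non-trivial element of `𝒞(𝒪)`.  Then we have `δ̃(A_T) = 2`,
`δ₀(A_T) = 0` so that `δ(A_T) = 1`."

T. Shioda, N. Mitani, LNM **412** (1974) [ShiodaMitani1974], §4 Thm. 4.7, (4.9), (4.14) (as in rows g16-#1 … g16-#5).
R. Laface, Asian J. Math. 23 (2019) [Laface2019DecompositionsSingularAbelianSurfaces], §3.1: `δ`, `δ̃`, `δ₀`,
`δ̃(A) = 2δ(A) − δ₀(A)`; Cor. 3.2 `δ̃(A) = h(D)`.  D. A. Cox [Cox2013], §3.A Thm. 3.9, Lemma 3.10; §2.A Thm. 2.8.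

## Carriers (as in rows g16-#1 … g16-#5; no new definition)

`A_Q = prodPeriod (ellipticPeriod τ₁) (ellipticPeriod τ₂)` for `Q = (a, b, c)` primitive, `0 < a`, `b² < 4ac`,
`D = b² - 4ac`, principal companion `P = (1, b, ac)` (`A_P ≅ ℂ/𝔒 × ℂ/𝔒`), `h(D) = BinQF.classNumber D`; and
REPRESENTING SETS taken as HYPOTHESES: `DecU ⊂ ℍ²` represents the decompositions of a complex torus `X` up to
interchanging the factors if every member `(s₁, s₂)` is a decomposition `E_{s₁} × E_{s₂} ≅ X` and every decomposition
`E_{ω₁} × E_{ω₂} ≅ X` is isomorphic — strictly or after the swap — to EXACTLY ONE member; `Dec₀ ⊂ ℍ` represents the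
self-product decompositions likewise (the four clauses produced by row g16-#1's `card_decompositions_up_to_swap`).

## Contents (theorems only)

* §20 **the counts are well defined**: `card_eq_card_of_represents_selfProducts` (two sets representing the
  self-product decompositions of the same torus have the same cardinality — `δ₀(X)` is a number),
  `card_eq_card_of_represents_decompositions` (likewise `δ(X)`); hence
  **`two_mul_card_eq_classNumber_add_card`** — THM. 4.7 `2·#DecU = h(D) + #Dec₀` with `#Dec₀ ∈ {0, h₂}` for EVERY
  pair of representing sets of `A_Q` (row g16-#1 produced one pair).
* §21 **MA, EXAMPLE 5.13 as a criterion**: `classNumber_eq_one_of_card_eq_one` (`δ(A) = 1` with a self-product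
  decomposition ⟹ `h(D) = 1`, `δ₀ = 1`) and **`card_eq_one_and_card_eq_one_iff`** (`#DecU = 1 ∧ #Dec₀ = 1 ⟺ h(D) = 1`).
* §22 **MA, EXAMPLE 5.14 as a criterion**: **`card_eq_one_and_card_eq_zero_iff`** (`#DecU = 1 ∧ #Dec₀ = 0 ⟺
  h(D) = 2 ∧ Q ≁ (1, b, ac)`, i.e. `T_A` is the non-trivial class), via the forms lemma "`h(D) = 2 ⟹` every
  reduced form of discriminant `D` is ambiguous" (`C(D)` has order `2`; Cox Thm. 3.9 / Lemma 3.10, elementary).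
* §23 **the `δ(A) = 1` dichotomy for primitive `T_A`** (Ma §5.3 (i)/(ii)): **`card_eq_one_iff`**.
* §24 the first instance of Example 5.14, `-d(𝒪) = 15`: `card_decompositions_two_one_two` (`A_{(2,1,2)}`: `δ = 1`,
  `δ₀ = 0`, `h(-15) = 2`).
* §25 **intrinsic forms** for a two-dimensional complex torus `X` with `ρ(X) = 4` and primitive `T_X` of Gram
  `(2a b; b 2c)`, through Thm. 3.2 (`X ≅ A_Q` or `A_{(a,-b,c)}`): `two_mul_card_eq_classNumber_add_card_of_singular`,
  **`card_eq_one_iff_of_singular`**.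

## Honest scope — NOT here

Ma §5.3 (iii) (imprimitive `T_A`), the lists of the thirteen / twenty-nine orders (class number one / two:
Heegner–Baker–Stark).

## References

* [Ma2011DecompositionsAbelianSurface] S. Ma, Ann. Inst. Fourier 61 (2011) 717–743: §5.3, Examples 5.13, 5.14;
  Cor. 5.8, Thm. 5.10.
* [ShiodaMitani1974] T. Shioda, N. Mitani, LNM 412 (1974) 259–287: §4 (4.9), (4.14), Thm. 4.7.
* [Laface2019DecompositionsSingularAbelianSurfaces] R. Laface, Asian J. Math. 23 (2019): §3.1, Cor. 3.2.
* [Cox2013] D. A. Cox, *Primes of the form x² + ny²*, 2nd ed. (2013): §2.A Thm. 2.8, Thm. 2.13; §3.A Thm. 3.9,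
  Lemma 3.10.
-/

noncomputable section

set_option maxSynthPendingDepth 3

open Module Complex
open scoped ComplexConjugate Pointwise

namespace Literature.Geometry.Kaehler

namespace ComplexTorus

namespace ShiodaMitani

open Literature.NumberTheory.QuadraticFields
open Literature.NumberTheory.QuadraticFields.Quadratic

/-! ## §20 The counts `δ₀(X)`, `δ(X)` are well defined; Thm. 4.7 for arbitrary representing sets -/

section WellDefined

variable {ι : Type*} [Fintype ι] [DecidableEq ι] {E : Type} [NormedAddCommGroup E] [NormedSpace ℂ E]
  {Ψ : (ι → ℝ) ≃L[ℝ] E}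

omit [DecidableEq ι] in
/-- One inequality of `card_eq_card_of_represents_selfProducts`: map each member of `T` to its representative in
`T'`. [cite: Laface2019DecompositionsSingularAbelianSurfaces, §3.1 (δ₀)] -/
private theorem card_le_card_of_represents_selfProducts {T T' : Finset ℂ}
    (hT : ∀ t ∈ T, ∃ (ht : 0 < t.im),
      IsIsomorphic (prodPeriod (ellipticPeriod ht.ne') (ellipticPeriod ht.ne')) Ψ)
    (hTu : ∀ (ω : ℂ) (hω : 0 < ω.im),
      IsIsomorphic (prodPeriod (ellipticPeriod hω.ne') (ellipticPeriod hω.ne')) Ψ →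
      ∃! t, t ∈ T ∧ ∃ (ht : 0 < t.im), IsIsomorphic (ellipticPeriod hω.ne') (ellipticPeriod ht.ne'))
    (hT'u : ∀ (ω : ℂ) (hω : 0 < ω.im),
      IsIsomorphic (prodPeriod (ellipticPeriod hω.ne') (ellipticPeriod hω.ne')) Ψ →
      ∃! t, t ∈ T' ∧ ∃ (ht : 0 < t.im), IsIsomorphic (ellipticPeriod hω.ne') (ellipticPeriod ht.ne')) :
    T.card ≤ T'.card := by
  classical
  have hrep : ∀ t ∈ T, ∃ t', t' ∈ T' ∧ ∃ (ht : 0 < t.im) (ht' : 0 < t'.im),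
      IsIsomorphic (ellipticPeriod ht.ne') (ellipticPeriod ht'.ne') := by
    intro t ht
    obtain ⟨hti, hiso⟩ := hT t ht
    obtain ⟨t', ⟨ht', hti', e⟩, -⟩ := hT'u t hti hiso
    exact ⟨t', ht', hti, hti', e⟩
  choose! f hf using hrep
  refine Finset.card_le_card_of_injOn f (fun t ht ↦ (hf t ht).1) ?_
  intro t₁ ht₁ t₂ ht₂ heq
  obtain ⟨-, h₁, h₁', e₁⟩ := hf t₁ ht₁
  obtain ⟨-, h₂, h₂', e₂⟩ := hf t₂ ht₂
  obtain ⟨hti₁, hiso₁⟩ := hT t₁ ht₁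
  obtain ⟨t₀, -, hu⟩ := hTu t₁ hti₁ hiso₁
  have e₂' : IsIsomorphic (ellipticPeriod h₁.ne') (ellipticPeriod h₂.ne') := by
    refine e₁.trans ?_
    have e₂s := e₂.symm
    simp only [heq] at e₂s ⊢
    exact e₂s
  exact (hu t₁ ⟨ht₁, hti₁, IsIsomorphic.refl _⟩).trans (hu t₂ ⟨ht₂, h₂, e₂'⟩).symm

omit [DecidableEq ι] in
/-- **`δ₀(X)` IS WELL DEFINED: two finite sets `T, T' ⊂ ℍ` each representing the curves `E` with `E × E ≅ X` up to
isomorphism (every member a solution, every solution isomorphic to exactly one member) have the same cardinality.**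
[cite: Laface2019DecompositionsSingularAbelianSurfaces, §3.1 (δ₀(A) := #{E : A ≅ E × E}/≅)] -/
theorem card_eq_card_of_represents_selfProducts {T T' : Finset ℂ}
    (hT : ∀ t ∈ T, ∃ (ht : 0 < t.im),
      IsIsomorphic (prodPeriod (ellipticPeriod ht.ne') (ellipticPeriod ht.ne')) Ψ)
    (hTu : ∀ (ω : ℂ) (hω : 0 < ω.im),
      IsIsomorphic (prodPeriod (ellipticPeriod hω.ne') (ellipticPeriod hω.ne')) Ψ →
      ∃! t, t ∈ T ∧ ∃ (ht : 0 < t.im), IsIsomorphic (ellipticPeriod hω.ne') (ellipticPeriod ht.ne'))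
    (hT' : ∀ t ∈ T', ∃ (ht : 0 < t.im),
      IsIsomorphic (prodPeriod (ellipticPeriod ht.ne') (ellipticPeriod ht.ne')) Ψ)
    (hT'u : ∀ (ω : ℂ) (hω : 0 < ω.im),
      IsIsomorphic (prodPeriod (ellipticPeriod hω.ne') (ellipticPeriod hω.ne')) Ψ →
      ∃! t, t ∈ T' ∧ ∃ (ht : 0 < t.im), IsIsomorphic (ellipticPeriod hω.ne') (ellipticPeriod ht.ne')) :
    T.card = T'.card :=
  le_antisymm (card_le_card_of_represents_selfProducts hT hTu hT'u)
    (card_le_card_of_represents_selfProducts hT' hT'u hTu)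

omit [DecidableEq ι] in
/-- One inequality of `card_eq_card_of_represents_decompositions`. [cite: Laface2019DecompositionsSingularAbelianSurfaces, §3.1 (δ)] -/
private theorem card_le_card_of_represents_decompositions {DecU DecU' : Finset (ℂ × ℂ)}
    (hadm : ∀ p ∈ DecU, ∃ (h₁ : 0 < p.1.im) (h₂ : 0 < p.2.im),
      IsIsomorphic (prodPeriod (ellipticPeriod h₁.ne') (ellipticPeriod h₂.ne')) Ψ)
    (huniq : ∀ (ω₁ ω₂ : ℂ) (hω₁ : 0 < ω₁.im) (hω₂ : 0 < ω₂.im),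
      IsIsomorphic (prodPeriod (ellipticPeriod hω₁.ne') (ellipticPeriod hω₂.ne')) Ψ →
      ∃! p, p ∈ DecU ∧ ∃ (h₁ : 0 < p.1.im) (h₂ : 0 < p.2.im),
        (IsIsomorphic (ellipticPeriod hω₁.ne') (ellipticPeriod h₁.ne') ∧
            IsIsomorphic (ellipticPeriod hω₂.ne') (ellipticPeriod h₂.ne')) ∨
          (IsIsomorphic (ellipticPeriod hω₁.ne') (ellipticPeriod h₂.ne') ∧
            IsIsomorphic (ellipticPeriod hω₂.ne') (ellipticPeriod h₁.ne')))
    (huniq' : ∀ (ω₁ ω₂ : ℂ) (hω₁ : 0 < ω₁.im) (hω₂ : 0 < ω₂.im),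
      IsIsomorphic (prodPeriod (ellipticPeriod hω₁.ne') (ellipticPeriod hω₂.ne')) Ψ →
      ∃! p, p ∈ DecU' ∧ ∃ (h₁ : 0 < p.1.im) (h₂ : 0 < p.2.im),
        (IsIsomorphic (ellipticPeriod hω₁.ne') (ellipticPeriod h₁.ne') ∧
            IsIsomorphic (ellipticPeriod hω₂.ne') (ellipticPeriod h₂.ne')) ∨
          (IsIsomorphic (ellipticPeriod hω₁.ne') (ellipticPeriod h₂.ne') ∧
            IsIsomorphic (ellipticPeriod hω₂.ne') (ellipticPeriod h₁.ne'))) :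
    DecU.card ≤ DecU'.card := by
  classical
  have hrep : ∀ p ∈ DecU, ∃ p', p' ∈ DecU' ∧ ∃ (h₁ : 0 < p.1.im) (h₂ : 0 < p.2.im) (h₁' : 0 < p'.1.im)
      (h₂' : 0 < p'.2.im),
      (IsIsomorphic (ellipticPeriod h₁.ne') (ellipticPeriod h₁'.ne') ∧
          IsIsomorphic (ellipticPeriod h₂.ne') (ellipticPeriod h₂'.ne')) ∨
        (IsIsomorphic (ellipticPeriod h₁.ne') (ellipticPeriod h₂'.ne') ∧
          IsIsomorphic (ellipticPeriod h₂.ne') (ellipticPeriod h₁'.ne')) := by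
    intro p hp
    obtain ⟨h₁, h₂, hiso⟩ := hadm p hp
    obtain ⟨p', ⟨hp', h₁', h₂', e⟩, -⟩ := huniq' p.1 p.2 h₁ h₂ hiso
    exact ⟨p', hp', h₁, h₂, h₁', h₂', e⟩
  choose! f hf using hrep
  refine Finset.card_le_card_of_injOn f (fun p hp ↦ (hf p hp).1) ?_
  intro p hp q hq heq
  obtain ⟨-, hp₁, hp₂, hp₁', hp₂', ep⟩ := hf p hp
  obtain ⟨-, hq₁, hq₂, hq₁', hq₂', eq'⟩ := hf q hq
  obtain ⟨hp₁'', hp₂'', hisop⟩ := hadm p hp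
  obtain ⟨p₀, -, hu⟩ := huniq p.1 p.2 hp₁'' hp₂'' hisop
  -- `q` is related to `p`: compose through the common representative `f p = f q`
  have eq : (IsIsomorphic (ellipticPeriod hq₁.ne') (ellipticPeriod hp₁'.ne') ∧
        IsIsomorphic (ellipticPeriod hq₂.ne') (ellipticPeriod hp₂'.ne')) ∨
      (IsIsomorphic (ellipticPeriod hq₁.ne') (ellipticPeriod hp₂'.ne') ∧
        IsIsomorphic (ellipticPeriod hq₂.ne') (ellipticPeriod hp₁'.ne')) := by
    simp only [heq] at eq' ⊢
    exact eq'
  have rel : (IsIsomorphic (ellipticPeriod hp₁.ne') (ellipticPeriod hq₁.ne') ∧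
        IsIsomorphic (ellipticPeriod hp₂.ne') (ellipticPeriod hq₂.ne')) ∨
      (IsIsomorphic (ellipticPeriod hp₁.ne') (ellipticPeriod hq₂.ne') ∧
        IsIsomorphic (ellipticPeriod hp₂.ne') (ellipticPeriod hq₁.ne')) := by
    rcases ep with ⟨a₁, a₂⟩ | ⟨a₁, a₂⟩ <;> rcases eq with ⟨b₁, b₂⟩ | ⟨b₁, b₂⟩
    · exact Or.inl ⟨a₁.trans b₁.symm, a₂.trans b₂.symm⟩
    · exact Or.inr ⟨a₁.trans b₂.symm, a₂.trans b₁.symm⟩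
    · exact Or.inr ⟨a₁.trans b₂.symm, a₂.trans b₁.symm⟩
    · exact Or.inl ⟨a₁.trans b₁.symm, a₂.trans b₂.symm⟩
  exact (hu p ⟨hp, hp₁'', hp₂'', Or.inl ⟨IsIsomorphic.refl _, IsIsomorphic.refl _⟩⟩).trans
    (hu q ⟨hq, hq₁, hq₂, rel⟩).symm

omit [DecidableEq ι] in
/-- **`δ(X)` IS WELL DEFINED: two finite sets `DecU, DecU' ⊂ ℍ²` each representing the decompositions
`E₁ × E₂ ≅ X` up to interchanging the factors (Laface: "(E₁, E₂) and (F₁, F₂) are isomorphic if `E₁ ≅ F₁` and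
`E₂ ≅ F₂`, or `E₁ ≅ F₂` and `E₂ ≅ F₁`") have the same cardinality.**
[cite: Laface2019DecompositionsSingularAbelianSurfaces, §3.1 (δ(A) := #Dec(A))] -/
theorem card_eq_card_of_represents_decompositions {DecU DecU' : Finset (ℂ × ℂ)}
    (hadm : ∀ p ∈ DecU, ∃ (h₁ : 0 < p.1.im) (h₂ : 0 < p.2.im),
      IsIsomorphic (prodPeriod (ellipticPeriod h₁.ne') (ellipticPeriod h₂.ne')) Ψ)
    (huniq : ∀ (ω₁ ω₂ : ℂ) (hω₁ : 0 < ω₁.im) (hω₂ : 0 < ω₂.im),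
      IsIsomorphic (prodPeriod (ellipticPeriod hω₁.ne') (ellipticPeriod hω₂.ne')) Ψ →
      ∃! p, p ∈ DecU ∧ ∃ (h₁ : 0 < p.1.im) (h₂ : 0 < p.2.im),
        (IsIsomorphic (ellipticPeriod hω₁.ne') (ellipticPeriod h₁.ne') ∧
            IsIsomorphic (ellipticPeriod hω₂.ne') (ellipticPeriod h₂.ne')) ∨
          (IsIsomorphic (ellipticPeriod hω₁.ne') (ellipticPeriod h₂.ne') ∧
            IsIsomorphic (ellipticPeriod hω₂.ne') (ellipticPeriod h₁.ne')))
    (hadm' : ∀ p ∈ DecU', ∃ (h₁ : 0 < p.1.im) (h₂ : 0 < p.2.im),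
      IsIsomorphic (prodPeriod (ellipticPeriod h₁.ne') (ellipticPeriod h₂.ne')) Ψ)
    (huniq' : ∀ (ω₁ ω₂ : ℂ) (hω₁ : 0 < ω₁.im) (hω₂ : 0 < ω₂.im),
      IsIsomorphic (prodPeriod (ellipticPeriod hω₁.ne') (ellipticPeriod hω₂.ne')) Ψ →
      ∃! p, p ∈ DecU' ∧ ∃ (h₁ : 0 < p.1.im) (h₂ : 0 < p.2.im),
        (IsIsomorphic (ellipticPeriod hω₁.ne') (ellipticPeriod h₁.ne') ∧
            IsIsomorphic (ellipticPeriod hω₂.ne') (ellipticPeriod h₂.ne')) ∨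
          (IsIsomorphic (ellipticPeriod hω₁.ne') (ellipticPeriod h₂.ne') ∧
            IsIsomorphic (ellipticPeriod hω₂.ne') (ellipticPeriod h₁.ne'))) :
    DecU.card = DecU'.card :=
  le_antisymm (card_le_card_of_represents_decompositions hadm huniq huniq')
    (card_le_card_of_represents_decompositions hadm' huniq' huniq)

end WellDefined

section Counts

variable {a b c : ℤ} (ha : 0 < a) (hΔ : b * b < 4 * a * c)

include ha hΔ in
/-- **SHIODA–MITANI THM. 4.7 FOR EVERY PAIR OF REPRESENTING SETS: `2δ(A) = h(D) + δ₀(A)` with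
`δ₀(A) ∈ {0, h₂(𝔒_{f₀})}`.**  For `A_Q`, `Q = (a, b, c)` primitive, `D = b² - 4ac`, and ANY finite sets `DecU ⊂ ℍ²`,
`Dec₀ ⊂ ℍ` representing its decompositions up to interchanging the factors, resp. its self-product decompositions:
`2·#DecU = h(D) + #Dec₀`, and `#Dec₀ = 0` or `#Dec₀ =` the number of ambiguous reduced forms of discriminant `D`
(row g16-#1 produced ONE such pair; §20 transfers the count to all). [cite: ShiodaMitani1974, §4 (4.9) and Thm. 4.7]
[cite: Laface2019DecompositionsSingularAbelianSurfaces, §3.1 and Cor. 3.2] [cite: Cox2013, §3.A Lemma 3.10] -/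
theorem two_mul_card_eq_classNumber_add_card (hm : (⟨a, b, c⟩ : BinQF).content = 1)
    {DecU : Finset (ℂ × ℂ)} {Dec₀ : Finset ℂ}
    (hadm : ∀ p ∈ DecU, ∃ (h₁ : 0 < p.1.im) (h₂ : 0 < p.2.im),
      IsIsomorphic (prodPeriod (ellipticPeriod h₁.ne') (ellipticPeriod h₂.ne'))
        (prodPeriod (ellipticPeriod (tau₁_im_pos ha hΔ).ne') (ellipticPeriod (tau₂_im_pos hΔ).ne')))
    (huniq : ∀ (ω₁ ω₂ : ℂ) (hω₁ : 0 < ω₁.im) (hω₂ : 0 < ω₂.im),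
      IsIsomorphic (prodPeriod (ellipticPeriod hω₁.ne') (ellipticPeriod hω₂.ne'))
          (prodPeriod (ellipticPeriod (tau₁_im_pos ha hΔ).ne') (ellipticPeriod (tau₂_im_pos hΔ).ne')) →
      ∃! p, p ∈ DecU ∧ ∃ (h₁ : 0 < p.1.im) (h₂ : 0 < p.2.im),
        (IsIsomorphic (ellipticPeriod hω₁.ne') (ellipticPeriod h₁.ne') ∧
            IsIsomorphic (ellipticPeriod hω₂.ne') (ellipticPeriod h₂.ne')) ∨
          (IsIsomorphic (ellipticPeriod hω₁.ne') (ellipticPeriod h₂.ne') ∧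
            IsIsomorphic (ellipticPeriod hω₂.ne') (ellipticPeriod h₁.ne')))
    (hD : ∀ s ∈ Dec₀, ∃ (hs : 0 < s.im),
      IsIsomorphic (prodPeriod (ellipticPeriod hs.ne') (ellipticPeriod hs.ne'))
        (prodPeriod (ellipticPeriod (tau₁_im_pos ha hΔ).ne') (ellipticPeriod (tau₂_im_pos hΔ).ne')))
    (hDu : ∀ (ω : ℂ) (hω : 0 < ω.im),
      IsIsomorphic (prodPeriod (ellipticPeriod hω.ne') (ellipticPeriod hω.ne'))
        (prodPeriod (ellipticPeriod (tau₁_im_pos ha hΔ).ne') (ellipticPeriod (tau₂_im_pos hΔ).ne')) →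
      ∃! s, s ∈ Dec₀ ∧ ∃ (hs : 0 < s.im), IsIsomorphic (ellipticPeriod hω.ne') (ellipticPeriod hs.ne')) :
    2 * DecU.card = BinQF.classNumber (b ^ 2 - 4 * a * c) + Dec₀.card ∧
      (Dec₀.card = 0 ∨ Dec₀.card = ((BinQF.reducedFormsList (b ^ 2 - 4 * a * c)).filter
        fun g ↦ g.b = 0 ∨ g.b = g.a ∨ g.a = g.c).length) := by
  obtain ⟨DecU', Dec₀', hcard, hadm', huniq', hD', hDu'⟩ := card_decompositions_up_to_swap ha hΔ hm
  rw [card_eq_card_of_represents_decompositions hadm huniq hadm' huniq',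
    card_eq_card_of_represents_selfProducts hD hDu hD' hDu']
  exact ⟨hcard, card_selfProducts_eq_zero_or_eq_length_filter ha hΔ hm hD' hDu'⟩

end Counts

/-! ## §21 Ma, Example 5.13 as a criterion: `Dec(A) = {(E, E)} ⟺ h(D) = 1` (primitive `T_A`) -/

section ClassNumberOne

variable {a b c : ℤ} (ha : 0 < a) (hΔ : b * b < 4 * a * c)

include ha hΔ in
/-- **MA, EXAMPLE 5.13 (`⟹`): if a singular abelian surface with primitive `T_A` has exactly one decomposition up to
interchanging the factors and that decomposition is a self-product (`Dec(A) = {(E, E)}`), then `h(D) = 1`** (and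
`δ₀(A) = 1`): `2·1 = h(D) + δ₀` with `δ₀ ≥ 1`, `h ≥ 1`. [cite: Ma2011DecompositionsAbelianSurface, Example 5.13 (proof)]
[cite: ShiodaMitani1974, §4 Thm. 4.7] -/
theorem classNumber_eq_one_of_card_eq_one (hm : (⟨a, b, c⟩ : BinQF).content = 1)
    {DecU : Finset (ℂ × ℂ)} {Dec₀ : Finset ℂ}
    (hadm : ∀ p ∈ DecU, ∃ (h₁ : 0 < p.1.im) (h₂ : 0 < p.2.im),
      IsIsomorphic (prodPeriod (ellipticPeriod h₁.ne') (ellipticPeriod h₂.ne'))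
        (prodPeriod (ellipticPeriod (tau₁_im_pos ha hΔ).ne') (ellipticPeriod (tau₂_im_pos hΔ).ne')))
    (huniq : ∀ (ω₁ ω₂ : ℂ) (hω₁ : 0 < ω₁.im) (hω₂ : 0 < ω₂.im),
      IsIsomorphic (prodPeriod (ellipticPeriod hω₁.ne') (ellipticPeriod hω₂.ne'))
          (prodPeriod (ellipticPeriod (tau₁_im_pos ha hΔ).ne') (ellipticPeriod (tau₂_im_pos hΔ).ne')) →
      ∃! p, p ∈ DecU ∧ ∃ (h₁ : 0 < p.1.im) (h₂ : 0 < p.2.im),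
        (IsIsomorphic (ellipticPeriod hω₁.ne') (ellipticPeriod h₁.ne') ∧
            IsIsomorphic (ellipticPeriod hω₂.ne') (ellipticPeriod h₂.ne')) ∨
          (IsIsomorphic (ellipticPeriod hω₁.ne') (ellipticPeriod h₂.ne') ∧
            IsIsomorphic (ellipticPeriod hω₂.ne') (ellipticPeriod h₁.ne')))
    (hD : ∀ s ∈ Dec₀, ∃ (hs : 0 < s.im),
      IsIsomorphic (prodPeriod (ellipticPeriod hs.ne') (ellipticPeriod hs.ne'))
        (prodPeriod (ellipticPeriod (tau₁_im_pos ha hΔ).ne') (ellipticPeriod (tau₂_im_pos hΔ).ne')))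
    (hDu : ∀ (ω : ℂ) (hω : 0 < ω.im),
      IsIsomorphic (prodPeriod (ellipticPeriod hω.ne') (ellipticPeriod hω.ne'))
        (prodPeriod (ellipticPeriod (tau₁_im_pos ha hΔ).ne') (ellipticPeriod (tau₂_im_pos hΔ).ne')) →
      ∃! s, s ∈ Dec₀ ∧ ∃ (hs : 0 < s.im), IsIsomorphic (ellipticPeriod hω.ne') (ellipticPeriod hs.ne'))
    (h1 : DecU.card = 1) (h0 : Dec₀.Nonempty) :
    BinQF.classNumber (b ^ 2 - 4 * a * c) = 1 ∧ Dec₀.card = 1 := by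
  have hD' : b ^ 2 - 4 * a * c < 0 := by nlinarith
  obtain ⟨hcard, -⟩ := two_mul_card_eq_classNumber_add_card ha hΔ hm hadm huniq hD hDu
  have hpos : 0 < BinQF.classNumber (b ^ 2 - 4 * a * c) :=
    BinQF.classNumber_pos hD' (BinQF.IsPosPrim.emod_four (f := ⟨a, b, c⟩)
      ⟨rfl, ha, (BinQF.isPrimitive_iff_content_eq_one _).2 hm⟩)
  have h0' : 0 < Dec₀.card := Finset.card_pos.2 h0
  rw [h1] at hcard
  omega

include ha hΔ in
/-- **MA, EXAMPLE 5.13 AS A CRITERION: for a singular abelian surface with primitive `T_A`, `D = -det T_A`,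
`Dec(A) = {(E, E)}` — exactly one decomposition up to interchanging the factors AND exactly one self-product
decomposition up to isomorphism of the curve — if and only if `h(D) = 1`** ("`δ̃(A) = 1` if and only if `T_A` is
primitive and `|𝒞(𝒪)| = 1`"; `⟸` is row g16-#4's `card_decompositions_of_classNumber_eq_one`, transferred to arbitrary
representing sets by §20). [cite: Ma2011DecompositionsAbelianSurface, Example 5.13] [cite: ShiodaMitani1974, §4 Thm. 4.7 and (4.9)] -/
theorem card_eq_one_and_card_eq_one_iff (hm : (⟨a, b, c⟩ : BinQF).content = 1)
    {DecU : Finset (ℂ × ℂ)} {Dec₀ : Finset ℂ}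
    (hadm : ∀ p ∈ DecU, ∃ (h₁ : 0 < p.1.im) (h₂ : 0 < p.2.im),
      IsIsomorphic (prodPeriod (ellipticPeriod h₁.ne') (ellipticPeriod h₂.ne'))
        (prodPeriod (ellipticPeriod (tau₁_im_pos ha hΔ).ne') (ellipticPeriod (tau₂_im_pos hΔ).ne')))
    (huniq : ∀ (ω₁ ω₂ : ℂ) (hω₁ : 0 < ω₁.im) (hω₂ : 0 < ω₂.im),
      IsIsomorphic (prodPeriod (ellipticPeriod hω₁.ne') (ellipticPeriod hω₂.ne'))
          (prodPeriod (ellipticPeriod (tau₁_im_pos ha hΔ).ne') (ellipticPeriod (tau₂_im_pos hΔ).ne')) →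
      ∃! p, p ∈ DecU ∧ ∃ (h₁ : 0 < p.1.im) (h₂ : 0 < p.2.im),
        (IsIsomorphic (ellipticPeriod hω₁.ne') (ellipticPeriod h₁.ne') ∧
            IsIsomorphic (ellipticPeriod hω₂.ne') (ellipticPeriod h₂.ne')) ∨
          (IsIsomorphic (ellipticPeriod hω₁.ne') (ellipticPeriod h₂.ne') ∧
            IsIsomorphic (ellipticPeriod hω₂.ne') (ellipticPeriod h₁.ne')))
    (hD : ∀ s ∈ Dec₀, ∃ (hs : 0 < s.im),
      IsIsomorphic (prodPeriod (ellipticPeriod hs.ne') (ellipticPeriod hs.ne'))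
        (prodPeriod (ellipticPeriod (tau₁_im_pos ha hΔ).ne') (ellipticPeriod (tau₂_im_pos hΔ).ne')))
    (hDu : ∀ (ω : ℂ) (hω : 0 < ω.im),
      IsIsomorphic (prodPeriod (ellipticPeriod hω.ne') (ellipticPeriod hω.ne'))
        (prodPeriod (ellipticPeriod (tau₁_im_pos ha hΔ).ne') (ellipticPeriod (tau₂_im_pos hΔ).ne')) →
      ∃! s, s ∈ Dec₀ ∧ ∃ (hs : 0 < s.im), IsIsomorphic (ellipticPeriod hω.ne') (ellipticPeriod hs.ne')) :
    (DecU.card = 1 ∧ Dec₀.card = 1) ↔ BinQF.classNumber (b ^ 2 - 4 * a * c) = 1 := by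
  constructor
  · rintro ⟨h1, h0⟩
    exact (classNumber_eq_one_of_card_eq_one ha hΔ hm hadm huniq hD hDu h1
      (Finset.card_pos.1 (by omega))).1
  · intro h1
    obtain ⟨hcard, hdich⟩ := two_mul_card_eq_classNumber_add_card ha hΔ hm hadm huniq hD hDu
    have hle : ((BinQF.reducedFormsList (b ^ 2 - 4 * a * c)).filter
        fun g ↦ g.b = 0 ∨ g.b = g.a ∨ g.a = g.c).length ≤ 1 := by
      have := List.length_filter_le (fun g : BinQF ↦ decide (g.b = 0 ∨ g.b = g.a ∨ g.a = g.c))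
        (BinQF.reducedFormsList (b ^ 2 - 4 * a * c))
      have hlen : (BinQF.reducedFormsList (b ^ 2 - 4 * a * c)).length = 1 := by
        simp only [BinQF.classNumber] at h1; exact h1
      omega
    rw [h1] at hcard
    omega

end ClassNumberOne

/-! ## §22 Ma, Example 5.14 as a criterion: `Dec(A) = {(E₁, E₂)}, E₁ ≄ E₂ ⟺ h(D) = 2 ∧ [T_A] ≠ 1` -/

section ClassNumberTwo

/-- The opposite of a primitive positive definite form is one. [cite: Cox2013, §3.A (opposite forms)] -/
private theorem isPosPrim_neg' {g : BinQF} {D : ℤ} (hg : g.IsPosPrim D) : (⟨g.a, -g.b, g.c⟩ : BinQF).IsPosPrim D := by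
  refine ⟨by rw [← hg.disc_eq]; simp [BinQF.disc], hg.a_pos, ?_⟩
  have hp := hg.primitive
  unfold BinQF.IsPrimitive at hp ⊢
  simpa [Int.natAbs_neg] using hp

/-- **When `h(D) = 2` every class is ambiguous** (the class group has order `2`): every reduced primitive positive
definite form of discriminant `D < 0` with exactly two reduced forms has `b = 0`, `b = a` or `a = c`.  Elementary
route: the reduced principal form `p₀ = (1, δ, (δ - D)/4)` (`δ ∈ {0, 1}`, `δ ≡ D (mod 2)`) is ambiguous; for the
other reduced form `g`, the reduced representative of its opposite `g'` is `g` (then `g ∼ g'`, ambiguous by Lemma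
3.10) or `p₀` (then `g ∼ p₀' ∼ p₀`, so `g = p₀` by Thm. 2.8). [cite: Cox2013, §3.A Thm. 3.9 and Lemma 3.10, §2.A Thm. 2.8] -/
private theorem forall_ambiguous_of_classNumber_eq_two {D : ℤ} (hD : D < 0) (h4 : D % 4 = 0 ∨ D % 4 = 1)
    (h2 : BinQF.classNumber D = 2) :
    ∀ g ∈ BinQF.reducedFormsList D, g.b = 0 ∨ g.b = g.a ∨ g.a = g.c := by
  classical
  -- the reduced principal form `p₀ = (1, δ, (δ - D)/4)`
  obtain ⟨δ, hδ01, hδD⟩ : ∃ δ : ℤ, (δ = 0 ∨ δ = 1) ∧ 4 ∣ δ - D := by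
    rcases h4 with h0 | h1
    · exact ⟨0, Or.inl rfl, by omega⟩
    · exact ⟨1, Or.inr rfl, by omega⟩
  set p₀ : BinQF := ⟨1, δ, (δ - D) / 4⟩ with hp₀def
  have hc₀ : 4 * ((δ - D) / 4) = δ - D := Int.mul_ediv_cancel' hδD
  have hp₀ : p₀.IsPosPrim D := by
    refine ⟨?_, one_pos, by simp [p₀, BinQF.IsPrimitive]⟩
    simp only [BinQF.disc, p₀]
    rcases hδ01 with rfl | rfl <;> omega
  have hp₀r : p₀.IsReduced := by
    refine ⟨?_, ?_, ?_⟩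
    · show |δ| ≤ 1
      rcases hδ01 with rfl | rfl <;> simp
    · show (1 : ℤ) ≤ (δ - D) / 4
      omega
    · intro _
      show (0 : ℤ) ≤ δ
      omega
  have hp₀amb : p₀.b = 0 ∨ p₀.b = p₀.a ∨ p₀.a = p₀.c := by
    rcases hδ01 with h | h
    · exact Or.inl h
    · exact Or.inr (Or.inl h)
  have hp₀mem : p₀ ∈ BinQF.reducedFormsList D := (BinQF.mem_reducedFormsList_iff p₀ hD).2 ⟨hp₀, hp₀r⟩
  intro g hg
  obtain ⟨hgp, hgr⟩ := (BinQF.mem_reducedFormsList_iff g hD).1 hg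
  by_cases hgp₀ : g = p₀
  · rw [hgp₀]; exact hp₀amb
  -- the reduced representative `r` of the opposite form `g'`
  have hneg : (⟨g.a, -g.b, g.c⟩ : BinQF).IsPosPrim D := isPosPrim_neg' hgp
  obtain ⟨r, hr, hrr⟩ := BinQF.exists_properEquiv_isReduced hD hneg
  have hrp : r.IsPosPrim D := by
    obtain ⟨p, q, u, v, hdet, he⟩ := hr; rw [he]; exact BinQF.IsPosPrim.act _ hD hneg hdet
  have hrmem : r ∈ BinQF.reducedFormsList D := (BinQF.mem_reducedFormsList_iff r hD).2 ⟨hrp, hrr⟩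
  -- the list has exactly the two members `p₀`, `g`
  have hset : (BinQF.reducedFormsList D).toFinset = {p₀, g} := by
    symm
    apply Finset.eq_of_subset_of_card_le
    · intro x hx
      rw [Finset.mem_insert, Finset.mem_singleton] at hx
      rw [List.mem_toFinset]
      rcases hx with rfl | rfl
      · exact hp₀mem
      · exact hg
    · rw [← BinQF.classNumber_eq_card, h2, Finset.card_pair (Ne.symm hgp₀)]
  have hr2 : r = p₀ ∨ r = g := by
    have : r ∈ (BinQF.reducedFormsList D).toFinset := List.mem_toFinset.2 hrmem
    rw [hset, Finset.mem_insert, Finset.mem_singleton] at this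
    exact this
  rcases hr2 with hr₀ | hrg
  · -- `g' ∼ p₀`, hence `g ∼ p₀' ∼ p₀` and `g = p₀`
    exfalso
    rw [hr₀] at hr
    have h1 : g.ProperEquiv ⟨p₀.a, -p₀.b, p₀.c⟩ := by
      have := properEquiv_neg_of_properEquiv hr
      simp only [neg_neg] at this
      obtain ⟨ga, gb, gc⟩ := g
      exact this
    have h2' : (⟨p₀.a, -p₀.b, p₀.c⟩ : BinQF).ProperEquiv p₀ :=
      ((properEquiv_neg_iff_of_isReduced hp₀ hp₀r).2 hp₀amb).symm
    exact hgp₀ (BinQF.eq_of_properEquiv_of_isReduced hgp hp₀ hgr hp₀r (h1.trans h2'))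
  · -- `g' ∼ g`: ambiguous by Lemma 3.10
    rw [hrg] at hr
    exact (properEquiv_neg_iff_of_isReduced hgp hgr).1 hr.symm

variable {a b c : ℤ} (ha : 0 < a) (hΔ : b * b < 4 * a * c)

include ha hΔ in
/-- **MA, EXAMPLE 5.14 AS A CRITERION: for a singular abelian surface `A = A_Q` with primitive `T_A` (`Q = (a, b, c)`
primitive, `D = b² - 4ac`), `Dec(A) = {(E₁, E₂)}` with `E₁ ≄ E₂` — exactly one decomposition up to interchanging
the factors and NO self-product decomposition — if and only if `h(D) = 2` and `Q` is not properly equivalent to the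
principal form `(1, b, ac)`** ("`|𝒞(𝒪)| = 2` … `T_A` corresponds to the non-trivial element of the class group";
`⟸`: both classes are ambiguous, so `δ₀(A) = 0` off the principal class by row g16-#4, and `2δ = 2 + 0`; `⟹`:
`2·1 = h + 0`, and `Q ∼ (1, b, ac)` would give `A ≅ ℂ/𝔒 × ℂ/𝔒 ≅ E × E`).
[cite: Ma2011DecompositionsAbelianSurface, Example 5.14] [cite: ShiodaMitani1974, §4 Thm. 4.7, (4.9), (4.14)]
[cite: Cox2013, §3.A Thm. 3.9 and Lemma 3.10] -/
theorem card_eq_one_and_card_eq_zero_iff (hm : (⟨a, b, c⟩ : BinQF).content = 1)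
    {DecU : Finset (ℂ × ℂ)} {Dec₀ : Finset ℂ}
    (hadm : ∀ p ∈ DecU, ∃ (h₁ : 0 < p.1.im) (h₂ : 0 < p.2.im),
      IsIsomorphic (prodPeriod (ellipticPeriod h₁.ne') (ellipticPeriod h₂.ne'))
        (prodPeriod (ellipticPeriod (tau₁_im_pos ha hΔ).ne') (ellipticPeriod (tau₂_im_pos hΔ).ne')))
    (huniq : ∀ (ω₁ ω₂ : ℂ) (hω₁ : 0 < ω₁.im) (hω₂ : 0 < ω₂.im),
      IsIsomorphic (prodPeriod (ellipticPeriod hω₁.ne') (ellipticPeriod hω₂.ne'))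
          (prodPeriod (ellipticPeriod (tau₁_im_pos ha hΔ).ne') (ellipticPeriod (tau₂_im_pos hΔ).ne')) →
      ∃! p, p ∈ DecU ∧ ∃ (h₁ : 0 < p.1.im) (h₂ : 0 < p.2.im),
        (IsIsomorphic (ellipticPeriod hω₁.ne') (ellipticPeriod h₁.ne') ∧
            IsIsomorphic (ellipticPeriod hω₂.ne') (ellipticPeriod h₂.ne')) ∨
          (IsIsomorphic (ellipticPeriod hω₁.ne') (ellipticPeriod h₂.ne') ∧
            IsIsomorphic (ellipticPeriod hω₂.ne') (ellipticPeriod h₁.ne')))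
    (hD : ∀ s ∈ Dec₀, ∃ (hs : 0 < s.im),
      IsIsomorphic (prodPeriod (ellipticPeriod hs.ne') (ellipticPeriod hs.ne'))
        (prodPeriod (ellipticPeriod (tau₁_im_pos ha hΔ).ne') (ellipticPeriod (tau₂_im_pos hΔ).ne')))
    (hDu : ∀ (ω : ℂ) (hω : 0 < ω.im),
      IsIsomorphic (prodPeriod (ellipticPeriod hω.ne') (ellipticPeriod hω.ne'))
        (prodPeriod (ellipticPeriod (tau₁_im_pos ha hΔ).ne') (ellipticPeriod (tau₂_im_pos hΔ).ne')) →
      ∃! s, s ∈ Dec₀ ∧ ∃ (hs : 0 < s.im), IsIsomorphic (ellipticPeriod hω.ne') (ellipticPeriod hs.ne')) :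
    (DecU.card = 1 ∧ Dec₀.card = 0) ↔
      (BinQF.classNumber (b ^ 2 - 4 * a * c) = 2 ∧ ¬ (⟨a, b, c⟩ : BinQF).ProperEquiv ⟨1, b, a * c⟩) := by
  have hD' : b ^ 2 - 4 * a * c < 0 := by nlinarith
  have hΔ' : b * b < 4 * 1 * (a * c) := by simpa only [mul_one, mul_assoc] using hΔ
  have h4 : (b ^ 2 - 4 * a * c) % 4 = 0 ∨ (b ^ 2 - 4 * a * c) % 4 = 1 :=
    BinQF.IsPosPrim.emod_four (f := ⟨a, b, c⟩) ⟨rfl, ha, (BinQF.isPrimitive_iff_content_eq_one _).2 hm⟩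
  obtain ⟨hcard, hdich⟩ := two_mul_card_eq_classNumber_add_card ha hΔ hm hadm huniq hD hDu
  constructor
  · rintro ⟨h1, h0⟩
    rw [h1, h0, add_zero] at hcard
    refine ⟨hcard.symm, fun hQP ↦ ?_⟩
    -- `A_Q ≅ A_P ≅ E_{τ₁(P)} × E_{τ₁(P)}`: a self-product decomposition, against `#Dec₀ = 0`
    have hAP := isIsomorphic_of_properEquiv (f := ⟨a, b, c⟩) (g := ⟨1, b, a * c⟩) ha hΔ one_pos hΔ' hQP
    have hself := (isIsomorphic_prodPeriod_self_tau₁ one_pos hΔ').trans hAP.symm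
    obtain ⟨s, ⟨hs, -⟩, -⟩ := hDu _ (tau₁_im_pos one_pos hΔ') hself
    rw [Finset.card_eq_zero] at h0
    rw [h0] at hs
    exact absurd hs (Finset.notMem_empty s)
  · rintro ⟨h2, hnot⟩
    have hall := forall_ambiguous_of_classNumber_eq_two hD' h4 h2
    have h0 : Dec₀ = ∅ := by
      refine Finset.eq_empty_of_forall_notMem fun s hs ↦ ?_
      obtain ⟨hs', hiso⟩ := hD s hs
      exact not_isIsomorphic_prodPeriod_self_of_forall_ambiguous ha hΔ hm hall hnot hs' hiso
    rw [h0, Finset.card_empty, add_zero, h2] at hcard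
    exact ⟨by omega, by rw [h0, Finset.card_empty]⟩

end ClassNumberTwo

/-! ## §23 The `δ(A) = 1` dichotomy for primitive `T_A` (Ma §5.3 (i)/(ii)) -/

section DecompositionNumberOne

variable {a b c : ℤ} (ha : 0 < a) (hΔ : b * b < 4 * a * c)

include ha hΔ in
/-- **ABELIAN SURFACES WITH `ρ(A) = 4`, PRIMITIVE `T_A` AND DECOMPOSITION NUMBER `δ(A) = 1` (Ma §5.3, classes (i) and
(ii)): `δ(A) = 1` if and only if EITHER `h(D) = 1` (then `δ₀(A) = 1`: `Dec(A) = {(E, E)}`, Example 5.13) OR `h(D) = 2`,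
`[T_A]` is the non-trivial class, and `δ₀(A) = 0` (`Dec(A) = {(E₁, E₂)}`, `E₁ ≄ E₂`, Example 5.14).**
[cite: Ma2011DecompositionsAbelianSurface, §5.3 and Examples 5.13, 5.14] [cite: ShiodaMitani1974, §4 Thm. 4.7] -/
theorem card_eq_one_iff (hm : (⟨a, b, c⟩ : BinQF).content = 1)
    {DecU : Finset (ℂ × ℂ)} {Dec₀ : Finset ℂ}
    (hadm : ∀ p ∈ DecU, ∃ (h₁ : 0 < p.1.im) (h₂ : 0 < p.2.im),
      IsIsomorphic (prodPeriod (ellipticPeriod h₁.ne') (ellipticPeriod h₂.ne'))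
        (prodPeriod (ellipticPeriod (tau₁_im_pos ha hΔ).ne') (ellipticPeriod (tau₂_im_pos hΔ).ne')))
    (huniq : ∀ (ω₁ ω₂ : ℂ) (hω₁ : 0 < ω₁.im) (hω₂ : 0 < ω₂.im),
      IsIsomorphic (prodPeriod (ellipticPeriod hω₁.ne') (ellipticPeriod hω₂.ne'))
          (prodPeriod (ellipticPeriod (tau₁_im_pos ha hΔ).ne') (ellipticPeriod (tau₂_im_pos hΔ).ne')) →
      ∃! p, p ∈ DecU ∧ ∃ (h₁ : 0 < p.1.im) (h₂ : 0 < p.2.im),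
        (IsIsomorphic (ellipticPeriod hω₁.ne') (ellipticPeriod h₁.ne') ∧
            IsIsomorphic (ellipticPeriod hω₂.ne') (ellipticPeriod h₂.ne')) ∨
          (IsIsomorphic (ellipticPeriod hω₁.ne') (ellipticPeriod h₂.ne') ∧
            IsIsomorphic (ellipticPeriod hω₂.ne') (ellipticPeriod h₁.ne')))
    (hD : ∀ s ∈ Dec₀, ∃ (hs : 0 < s.im),
      IsIsomorphic (prodPeriod (ellipticPeriod hs.ne') (ellipticPeriod hs.ne'))
        (prodPeriod (ellipticPeriod (tau₁_im_pos ha hΔ).ne') (ellipticPeriod (tau₂_im_pos hΔ).ne')))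
    (hDu : ∀ (ω : ℂ) (hω : 0 < ω.im),
      IsIsomorphic (prodPeriod (ellipticPeriod hω.ne') (ellipticPeriod hω.ne'))
        (prodPeriod (ellipticPeriod (tau₁_im_pos ha hΔ).ne') (ellipticPeriod (tau₂_im_pos hΔ).ne')) →
      ∃! s, s ∈ Dec₀ ∧ ∃ (hs : 0 < s.im), IsIsomorphic (ellipticPeriod hω.ne') (ellipticPeriod hs.ne')) :
    DecU.card = 1 ↔
      (BinQF.classNumber (b ^ 2 - 4 * a * c) = 1 ∧ Dec₀.card = 1) ∨
        (BinQF.classNumber (b ^ 2 - 4 * a * c) = 2 ∧ ¬ (⟨a, b, c⟩ : BinQF).ProperEquiv ⟨1, b, a * c⟩ ∧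
          Dec₀.card = 0) := by
  have hD' : b ^ 2 - 4 * a * c < 0 := by nlinarith
  obtain ⟨hcard, hdich⟩ := two_mul_card_eq_classNumber_add_card ha hΔ hm hadm huniq hD hDu
  have hpos : 0 < BinQF.classNumber (b ^ 2 - 4 * a * c) :=
    BinQF.classNumber_pos hD' (BinQF.IsPosPrim.emod_four (f := ⟨a, b, c⟩)
      ⟨rfl, ha, (BinQF.isPrimitive_iff_content_eq_one _).2 hm⟩)
  constructor
  · intro h1
    rw [h1] at hcard
    -- `h + #Dec₀ = 2` with `h ≥ 1`: `(h, #Dec₀) = (1, 1)` or `(2, 0)`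
    by_cases h0 : Dec₀.card = 0
    · right
      have h2 : BinQF.classNumber (b ^ 2 - 4 * a * c) = 2 := by omega
      exact ⟨h2, ((card_eq_one_and_card_eq_zero_iff ha hΔ hm hadm huniq hD hDu).1 ⟨h1, h0⟩).2, h0⟩
    · left
      constructor <;> omega
  · rintro (⟨h1, h0⟩ | ⟨h2, hnot, h0⟩)
    · rw [h1, h0] at hcard; omega
    · exact ((card_eq_one_and_card_eq_zero_iff ha hΔ hm hadm huniq hD hDu).2 ⟨h2, hnot⟩).1

end DecompositionNumberOne

/-! ## §24 The first instance of Example 5.14: `-d(𝒪) = 15`, `A_{(2,1,2)} = E_{(-1+√-15)/4} × E_{(1+√-15)/2}` -/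

section ExampleFifteen

/-- **`D = -15`, the smallest discriminant of class number two: `A_{(2,1,2)}` has `δ(A) = 1`, `δ₀(A) = 0`**
(`h(-15) = 2`, reduced forms `(1,1,4)`, `(2,1,2)`; `T_A` is the non-trivial class) — the first entry `-d(𝒪) = 15` of
Ma's list in Example 5.14. [cite: Ma2011DecompositionsAbelianSurface, Example 5.14] [cite: Cox2013, §2.A Thm. 2.8] -/
theorem card_decompositions_two_one_two (ha : (0 : ℤ) < 2) (hΔ : (1 : ℤ) * 1 < 4 * 2 * 2) :
    BinQF.classNumber ((1 : ℤ) ^ 2 - 4 * 2 * 2) = 2 ∧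
    ∃ (DecU : Finset (ℂ × ℂ)) (Dec₀ : Finset ℂ), DecU.card = 1 ∧ Dec₀.card = 0 ∧
      (∀ p ∈ DecU, ∃ (h₁ : 0 < p.1.im) (h₂ : 0 < p.2.im),
        IsIsomorphic (prodPeriod (ellipticPeriod h₁.ne') (ellipticPeriod h₂.ne'))
          (prodPeriod (ellipticPeriod (tau₁_im_pos ha hΔ).ne') (ellipticPeriod (tau₂_im_pos hΔ).ne'))) ∧
      (∀ (ω₁ ω₂ : ℂ) (hω₁ : 0 < ω₁.im) (hω₂ : 0 < ω₂.im),
        IsIsomorphic (prodPeriod (ellipticPeriod hω₁.ne') (ellipticPeriod hω₂.ne'))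
          (prodPeriod (ellipticPeriod (tau₁_im_pos ha hΔ).ne') (ellipticPeriod (tau₂_im_pos hΔ).ne')) →
        ∃! p, p ∈ DecU ∧ ∃ (h₁ : 0 < p.1.im) (h₂ : 0 < p.2.im),
          (IsIsomorphic (ellipticPeriod hω₁.ne') (ellipticPeriod h₁.ne') ∧
              IsIsomorphic (ellipticPeriod hω₂.ne') (ellipticPeriod h₂.ne')) ∨
            (IsIsomorphic (ellipticPeriod hω₁.ne') (ellipticPeriod h₂.ne') ∧
              IsIsomorphic (ellipticPeriod hω₂.ne') (ellipticPeriod h₁.ne'))) ∧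
      ∀ (ω : ℂ) (hω : 0 < ω.im),
        ¬ IsIsomorphic (prodPeriod (ellipticPeriod hω.ne') (ellipticPeriod hω.ne'))
          (prodPeriod (ellipticPeriod (tau₁_im_pos ha hΔ).ne') (ellipticPeriod (tau₂_im_pos hΔ).ne')) := by
  have hh : BinQF.classNumber ((1 : ℤ) ^ 2 - 4 * 2 * 2) = 2 := by decide
  have hnot : ¬ (⟨2, 1, 2⟩ : BinQF).ProperEquiv ⟨1, 1, 2 * 2⟩ := by
    intro h
    have heq := BinQF.eq_of_properEquiv_of_isReduced (D := -15) (by decide) (by decide) (by decide) (by decide) h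
    exact absurd heq (by decide)
  refine ⟨hh, ?_⟩
  obtain ⟨DecU, Dec₀, -, hadm, huniq, hD, hDu⟩ := card_decompositions_up_to_swap ha hΔ (by decide)
  obtain ⟨h1, h0⟩ := (card_eq_one_and_card_eq_zero_iff ha hΔ (by decide) hadm huniq hD hDu).2 ⟨hh, hnot⟩
  refine ⟨DecU, Dec₀, h1, h0, hadm, huniq, fun ω hω hiso ↦ ?_⟩
  obtain ⟨s, ⟨hs, -⟩, -⟩ := hDu ω hω hiso
  rw [Finset.card_eq_zero] at h0
  rw [h0] at hs
  exact absurd hs (Finset.notMem_empty s)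

end ExampleFifteen

/-! ## §25 Intrinsic forms: a two-dimensional complex torus with `ρ = 4` and primitive `T_X` (through Thm. 3.2) -/

section Intrinsic

variable {ι : Type*} [Fintype ι] [DecidableEq ι] {E : Type} [NormedAddCommGroup E] [NormedSpace ℂ E]
  {Φ : (ι → ℝ) ≃L[ℝ] E}

omit [DecidableEq ι] in
/-- Representing sets of `X` (clauses written `X ≅ E₁ × E₂`) are representing sets of any model `A ≅ X` (clauses
written `E₁ × E₂ ≅ A`, the shape of the model theorems). [cite: Laface2019DecompositionsSingularAbelianSurfaces, §3.1] -/
private theorem represents_model_of_represents {ι' : Type*} [Fintype ι'] {E' : Type*} [NormedAddCommGroup E']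
    [NormedSpace ℂ E'] {A : (ι' → ℝ) ≃L[ℝ] E'} (hA : IsIsomorphic Φ A) {DecU : Finset (ℂ × ℂ)} {Dec₀ : Finset ℂ}
    (hadm : ∀ p ∈ DecU, ∃ (h₁ : 0 < p.1.im) (h₂ : 0 < p.2.im),
      IsIsomorphic Φ (prodPeriod (ellipticPeriod h₁.ne') (ellipticPeriod h₂.ne')))
    (huniq : ∀ (ω₁ ω₂ : ℂ) (hω₁ : 0 < ω₁.im) (hω₂ : 0 < ω₂.im),
      IsIsomorphic Φ (prodPeriod (ellipticPeriod hω₁.ne') (ellipticPeriod hω₂.ne')) →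
      ∃! p, p ∈ DecU ∧ ∃ (h₁ : 0 < p.1.im) (h₂ : 0 < p.2.im),
        (IsIsomorphic (ellipticPeriod hω₁.ne') (ellipticPeriod h₁.ne') ∧
            IsIsomorphic (ellipticPeriod hω₂.ne') (ellipticPeriod h₂.ne')) ∨
          (IsIsomorphic (ellipticPeriod hω₁.ne') (ellipticPeriod h₂.ne') ∧
            IsIsomorphic (ellipticPeriod hω₂.ne') (ellipticPeriod h₁.ne')))
    (hD : ∀ s ∈ Dec₀, ∃ (hs : 0 < s.im),
      IsIsomorphic Φ (prodPeriod (ellipticPeriod hs.ne') (ellipticPeriod hs.ne')))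
    (hDu : ∀ (ω : ℂ) (hω : 0 < ω.im),
      IsIsomorphic Φ (prodPeriod (ellipticPeriod hω.ne') (ellipticPeriod hω.ne')) →
      ∃! s, s ∈ Dec₀ ∧ ∃ (hs : 0 < s.im), IsIsomorphic (ellipticPeriod hω.ne') (ellipticPeriod hs.ne')) :
    (∀ p ∈ DecU, ∃ (h₁ : 0 < p.1.im) (h₂ : 0 < p.2.im),
        IsIsomorphic (prodPeriod (ellipticPeriod h₁.ne') (ellipticPeriod h₂.ne')) A) ∧
      (∀ (ω₁ ω₂ : ℂ) (hω₁ : 0 < ω₁.im) (hω₂ : 0 < ω₂.im),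
        IsIsomorphic (prodPeriod (ellipticPeriod hω₁.ne') (ellipticPeriod hω₂.ne')) A →
        ∃! p, p ∈ DecU ∧ ∃ (h₁ : 0 < p.1.im) (h₂ : 0 < p.2.im),
          (IsIsomorphic (ellipticPeriod hω₁.ne') (ellipticPeriod h₁.ne') ∧
              IsIsomorphic (ellipticPeriod hω₂.ne') (ellipticPeriod h₂.ne')) ∨
            (IsIsomorphic (ellipticPeriod hω₁.ne') (ellipticPeriod h₂.ne') ∧
              IsIsomorphic (ellipticPeriod hω₂.ne') (ellipticPeriod h₁.ne'))) ∧
      (∀ s ∈ Dec₀, ∃ (hs : 0 < s.im),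
        IsIsomorphic (prodPeriod (ellipticPeriod hs.ne') (ellipticPeriod hs.ne')) A) ∧
      ∀ (ω : ℂ) (hω : 0 < ω.im),
        IsIsomorphic (prodPeriod (ellipticPeriod hω.ne') (ellipticPeriod hω.ne')) A →
        ∃! s, s ∈ Dec₀ ∧ ∃ (hs : 0 < s.im), IsIsomorphic (ellipticPeriod hω.ne') (ellipticPeriod hs.ne') := by
  refine ⟨fun p hp ↦ ?_, fun ω₁ ω₂ hω₁ hω₂ h ↦ huniq ω₁ ω₂ hω₁ hω₂ (hA.trans h.symm), fun s hs ↦ ?_,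
    fun ω hω h ↦ hDu ω hω (hA.trans h.symm)⟩
  · obtain ⟨h₁, h₂, h⟩ := hadm p hp
    exact ⟨h₁, h₂, h.symm.trans hA⟩
  · obtain ⟨hs', h⟩ := hD s hs
    exact ⟨hs', h.symm.trans hA⟩

/-- `(a, -b, c)` is primitive with `(a, b, c)`. [cite: Cox2013, §2.A] -/
private theorem content_neg_eq' {a b c : ℤ} : (⟨a, -b, c⟩ : BinQF).content = (⟨a, b, c⟩ : BinQF).content := by
  simp only [BinQF.content, Int.natAbs_neg]

/-- `(a, -b, c) ∼ (1, -b, ac)` iff `(a, b, c) ∼ (1, b, ac)` (opposite forms on both sides). [cite: Cox2013, §3.A Thm. 3.9] -/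
private theorem properEquiv_principal_neg_iff {a b c : ℤ} :
    (⟨a, -b, c⟩ : BinQF).ProperEquiv ⟨1, -b, a * c⟩ ↔ (⟨a, b, c⟩ : BinQF).ProperEquiv ⟨1, b, a * c⟩ := by
  constructor
  · intro h
    have := properEquiv_neg_of_properEquiv h
    simp only [neg_neg] at this
    exact this
  · intro h
    exact properEquiv_neg_of_properEquiv h

/-- **THM. 4.7 WITH (4.9) FOR EVERY PAIR OF REPRESENTING SETS OF AN INTRINSIC SINGULAR ABELIAN SURFACE `X`** (a
two-dimensional complex torus with `ρ(X) = 4`, `T_X = ℤu₁ + ℤu₂` primitive of Gram matrix `(2a b; b 2c)`,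
`D = b² - 4ac`): any finite `DecU ⊂ ℍ²`, `Dec₀ ⊂ ℍ` representing the decompositions `X ≅ E₁ × E₂` up to
interchanging the factors, resp. the self-product decompositions `X ≅ E × E`, satisfy `2·#DecU = h(D) + #Dec₀` with
`#Dec₀ = 0 ∨ #Dec₀ =` the number of ambiguous reduced forms of discriminant `D` (Thm. 3.2: `X ≅ A_Q` or
`X ≅ A_{(a,-b,c)}`, rows g13-#9 / g13-#2; then §20). [cite: ShiodaMitani1974, §4 Thm. 4.7 and (4.9), with §3 Thm. 3.2]
[cite: Laface2019DecompositionsSingularAbelianSurfaces, §3.1 and Cor. 3.2] -/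
theorem two_mul_card_eq_classNumber_add_card_of_singular (e : Fin 4 ≃ ι) (he : orientationSign Φ e = 1)
    (hρ : finrank ℚ (hodgeClasses Φ 1) = 4) {a b c : ℤ} (ha : 0 < a) (hΔ : b * b < 4 * a * c)
    (hm : (⟨a, b, c⟩ : BinQF).content = 1) {u₁ u₂ : E [⋀^Fin 2]→L[ℝ] ℂ} (hu₁ : u₁ ∈ transcendentalLattice Φ)
    (hu₂ : u₂ ∈ transcendentalLattice Φ)
    (hspan : ∀ x ∈ transcendentalLattice Φ, ∃ p r : ℤ, x = (p : ℂ) • u₁ + (r : ℂ) • u₂)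
    (h₁₁ : torusIntegral Φ e (u₁.wedge u₁) = 2 * a) (h₁₂ : torusIntegral Φ e (u₁.wedge u₂) = b)
    (h₂₂ : torusIntegral Φ e (u₂.wedge u₂) = 2 * c) {DecU : Finset (ℂ × ℂ)} {Dec₀ : Finset ℂ}
    (hadm : ∀ p ∈ DecU, ∃ (h₁ : 0 < p.1.im) (h₂ : 0 < p.2.im),
      IsIsomorphic Φ (prodPeriod (ellipticPeriod h₁.ne') (ellipticPeriod h₂.ne')))
    (huniq : ∀ (ω₁ ω₂ : ℂ) (hω₁ : 0 < ω₁.im) (hω₂ : 0 < ω₂.im),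
      IsIsomorphic Φ (prodPeriod (ellipticPeriod hω₁.ne') (ellipticPeriod hω₂.ne')) →
      ∃! p, p ∈ DecU ∧ ∃ (h₁ : 0 < p.1.im) (h₂ : 0 < p.2.im),
        (IsIsomorphic (ellipticPeriod hω₁.ne') (ellipticPeriod h₁.ne') ∧
            IsIsomorphic (ellipticPeriod hω₂.ne') (ellipticPeriod h₂.ne')) ∨
          (IsIsomorphic (ellipticPeriod hω₁.ne') (ellipticPeriod h₂.ne') ∧
            IsIsomorphic (ellipticPeriod hω₂.ne') (ellipticPeriod h₁.ne')))
    (hD : ∀ s ∈ Dec₀, ∃ (hs : 0 < s.im),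
      IsIsomorphic Φ (prodPeriod (ellipticPeriod hs.ne') (ellipticPeriod hs.ne')))
    (hDu : ∀ (ω : ℂ) (hω : 0 < ω.im),
      IsIsomorphic Φ (prodPeriod (ellipticPeriod hω.ne') (ellipticPeriod hω.ne')) →
      ∃! s, s ∈ Dec₀ ∧ ∃ (hs : 0 < s.im), IsIsomorphic (ellipticPeriod hω.ne') (ellipticPeriod hs.ne')) :
    2 * DecU.card = BinQF.classNumber (b ^ 2 - 4 * a * c) + Dec₀.card ∧
      (Dec₀.card = 0 ∨ Dec₀.card = ((BinQF.reducedFormsList (b ^ 2 - 4 * a * c)).filter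
        fun g ↦ g.b = 0 ∨ g.b = g.a ∨ g.a = g.c).length) := by
  rcases isIsomorphic_or_isIsomorphic_conj_of_transcendentalLattice_eq e he hρ ha hΔ hu₁ hu₂ hspan h₁₁ h₁₂ h₂₂
    with hA | hA
  · obtain ⟨hadm', huniq', hD', hDu'⟩ := represents_model_of_represents hA hadm huniq hD hDu
    exact two_mul_card_eq_classNumber_add_card ha hΔ hm hadm' huniq' hD' hDu'
  · have hΔn : (-b) * (-b) < 4 * a * c := by rw [neg_mul_neg]; exact hΔ
    have hA' := hA.trans (isIsomorphic_conj ha hΔ (conj_tau₁_im_neg ha hΔ).ne (conj_tau₂_im_neg hΔ).ne)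
    obtain ⟨hadm', huniq', hD', hDu'⟩ := represents_model_of_represents hA' hadm huniq hD hDu
    have h := two_mul_card_eq_classNumber_add_card ha hΔn (by rw [content_neg_eq']; exact hm) hadm' huniq' hD' hDu'
    rwa [neg_sq] at h

/-- **MA §5.3 FOR AN INTRINSIC SINGULAR ABELIAN SURFACE WITH PRIMITIVE `T_X` — THE `δ(X) = 1` DICHOTOMY:** with
`X`, `(a, b, c)`, `D` and representing sets `DecU`, `Dec₀` as in `two_mul_card_eq_classNumber_add_card_of_singular`,
`#DecU = 1` if and only if EITHER `h(D) = 1` and `#Dec₀ = 1` (`Dec(X) = {(E, E)}`, Example 5.13) OR `h(D) = 2`,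
`(a, b, c) ≁ (1, b, ac)` (the Gram form of `T_X` is the non-trivial class) and `#Dec₀ = 0` (`Dec(X) = {(E₁, E₂)}`,
`E₁ ≄ E₂`, Example 5.14). [cite: Ma2011DecompositionsAbelianSurface, §5.3 and Examples 5.13, 5.14]
[cite: ShiodaMitani1974, §4 Thm. 4.7, with §3 Thm. 3.2] -/
theorem card_eq_one_iff_of_singular (e : Fin 4 ≃ ι) (he : orientationSign Φ e = 1)
    (hρ : finrank ℚ (hodgeClasses Φ 1) = 4) {a b c : ℤ} (ha : 0 < a) (hΔ : b * b < 4 * a * c)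
    (hm : (⟨a, b, c⟩ : BinQF).content = 1) {u₁ u₂ : E [⋀^Fin 2]→L[ℝ] ℂ} (hu₁ : u₁ ∈ transcendentalLattice Φ)
    (hu₂ : u₂ ∈ transcendentalLattice Φ)
    (hspan : ∀ x ∈ transcendentalLattice Φ, ∃ p r : ℤ, x = (p : ℂ) • u₁ + (r : ℂ) • u₂)
    (h₁₁ : torusIntegral Φ e (u₁.wedge u₁) = 2 * a) (h₁₂ : torusIntegral Φ e (u₁.wedge u₂) = b)
    (h₂₂ : torusIntegral Φ e (u₂.wedge u₂) = 2 * c) {DecU : Finset (ℂ × ℂ)} {Dec₀ : Finset ℂ}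
    (hadm : ∀ p ∈ DecU, ∃ (h₁ : 0 < p.1.im) (h₂ : 0 < p.2.im),
      IsIsomorphic Φ (prodPeriod (ellipticPeriod h₁.ne') (ellipticPeriod h₂.ne')))
    (huniq : ∀ (ω₁ ω₂ : ℂ) (hω₁ : 0 < ω₁.im) (hω₂ : 0 < ω₂.im),
      IsIsomorphic Φ (prodPeriod (ellipticPeriod hω₁.ne') (ellipticPeriod hω₂.ne')) →
      ∃! p, p ∈ DecU ∧ ∃ (h₁ : 0 < p.1.im) (h₂ : 0 < p.2.im),
        (IsIsomorphic (ellipticPeriod hω₁.ne') (ellipticPeriod h₁.ne') ∧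
            IsIsomorphic (ellipticPeriod hω₂.ne') (ellipticPeriod h₂.ne')) ∨
          (IsIsomorphic (ellipticPeriod hω₁.ne') (ellipticPeriod h₂.ne') ∧
            IsIsomorphic (ellipticPeriod hω₂.ne') (ellipticPeriod h₁.ne')))
    (hD : ∀ s ∈ Dec₀, ∃ (hs : 0 < s.im),
      IsIsomorphic Φ (prodPeriod (ellipticPeriod hs.ne') (ellipticPeriod hs.ne')))
    (hDu : ∀ (ω : ℂ) (hω : 0 < ω.im),
      IsIsomorphic Φ (prodPeriod (ellipticPeriod hω.ne') (ellipticPeriod hω.ne')) →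
      ∃! s, s ∈ Dec₀ ∧ ∃ (hs : 0 < s.im), IsIsomorphic (ellipticPeriod hω.ne') (ellipticPeriod hs.ne')) :
    DecU.card = 1 ↔
      (BinQF.classNumber (b ^ 2 - 4 * a * c) = 1 ∧ Dec₀.card = 1) ∨
        (BinQF.classNumber (b ^ 2 - 4 * a * c) = 2 ∧ ¬ (⟨a, b, c⟩ : BinQF).ProperEquiv ⟨1, b, a * c⟩ ∧
          Dec₀.card = 0) := by
  rcases isIsomorphic_or_isIsomorphic_conj_of_transcendentalLattice_eq e he hρ ha hΔ hu₁ hu₂ hspan h₁₁ h₁₂ h₂₂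
    with hA | hA
  · obtain ⟨hadm', huniq', hD', hDu'⟩ := represents_model_of_represents hA hadm huniq hD hDu
    exact card_eq_one_iff ha hΔ hm hadm' huniq' hD' hDu'
  · have hΔn : (-b) * (-b) < 4 * a * c := by rw [neg_mul_neg]; exact hΔ
    have hA' := hA.trans (isIsomorphic_conj ha hΔ (conj_tau₁_im_neg ha hΔ).ne (conj_tau₂_im_neg hΔ).ne)
    obtain ⟨hadm', huniq', hD', hDu'⟩ := represents_model_of_represents hA' hadm huniq hD hDu
    have h := card_eq_one_iff ha hΔn (by rw [content_neg_eq']; exact hm) hadm' huniq' hD' hDu'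
    rw [neg_sq, properEquiv_principal_neg_iff] at h
    exact h

end Intrinsic

end ShiodaMitani

end ComplexTorus

end Literature.Geometry.Kaehler

end
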